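import Mathlib
import HarnessLib
import Summits.AtomisticToContinuum.FouriersLaw.Theorems.JunctionLocalitySuperadditiveResistanceDeviceBlockCoordinates
import Literature.MathematicalPhysics.KineticTheory.LangevinChainNESSProofs

/-!
# Device block restriction: the probed `(N+M)`-device restricted to its left block IS the bare
`N`-chain plus the junction force (helper for stub `stub_terminationLocality`, line
`thermalise-then-cut-probe-insertion`, crux `JunctionLocality.SuperadditiveResistance`,
stmt-AtomisticToContinuum-11748) — part 2

The stub (termination locality TL⁺: `L₁₁ ≤ G_N (1 + c G_N)`, `L₄₄ ≤ G_M (1 + c G_M)`) compares the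
end-bath self-conductances of the line's DEVICE — the `(N+M)`-chain `P` between its end baths with
two extra Langevin thermostats of the chain's own coupling `P.γ` on the junction momenta
`p_{N-1}, p_N` — with the two-terminal conductances `G_N = D_N/(N-1)`, `G_M` of the bare pieces.
Its fixed-`N` skeleton is the exact operator identity proved here (pointwise, for every terminal
temperature profile `τ`, every block function `f`, differentiable potentials; the block maps
`π_N x = (x.1 ∘ Fin.castAdd M, x.2 ∘ Fin.castAdd M)`, `π'_M x = (x.1 ∘ Fin.natAdd N, x.2 ∘ Fin.natAdd N)`
of part 1 are written out as lambdas):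

* `device_comp_restrictLeft`: on functions of the sites `0, …, N-1`,
  `L_dev (f ∘ π_N) = (L_N^{τ 0, τ 1} f) ∘ π_N + V'(q_N − q_{N-1}) · (∂_{p_{N-1}} f) ∘ π_N`
  — the probe on site `N-1` (coupling `γ`, temperature `τ 1`) plays EXACTLY the bare `N`-chain's
  right bath; the probe on `N`, the `M-1` further sites and the far bath are invisible; the only
  coupling is the junction force `Λ = V'(r_J) ∂_{p_{N-1}}`;
* `device_comp_restrictRight`: on functions of the sites `N, …, N+M-1`,
  `L_dev (f ∘ π'_M) = (L_M^{τ 2, τ 3} f) ∘ π'_M − V'(q_N − q_{N-1}) · (∂_{p_0} f) ∘ π'_M`;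
* `generator_comp_restrictLeft/Right` (plain `(N+M)`-chain: bare block generator minus its
  inner bath term ± the junction force); `pinnedChain_device_comp_restrictLeft/Right`.

The device statements are written with the probe sums UNFOLDED, i.e. their left-hand sides are
`deviceGenerator P N M τ (f ∘ π_N) x` of the line's skeleton after `simp only [deviceGenerator,
thermo]` (or by `exact`, definitionally): usable next to any copy of the line vocabulary.

USE (the Duhamel/resolvent reduction of TL, recorded in the stub's log): with `H_N` the bare
`N`-chain's equilibrium forward field of `p_0² − T` (`L_N^{T,T} H_N = −(p_0² − T)`), the identity
gives `L_dev (H_N ∘ π_N) = −(p_0² − T) + V'(r_J) (∂_{p_{N-1}} H_N) ∘ π_N` pointwise, whence (after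
the Green pairing against the device's backward field `ḡ₁ ∘ R`)
`(T²/γ²)(G_N − L₁₁) = [E_{μ_T^{N+M}}((p_0²−T)·H_N∘π_N) − E_{μ_T^N}((p_0²−T)·H_N)]
  + E_{μ_T^{N+M}}((ḡ₁∘R) · V'(r_J) · (∂_{p_{N-1}}H_N)∘π_N)`;
TL⁺ is the `N`-uniform bound `≥ −(T²/γ²) c G_N²` on the right-hand side (not in tree or print).
-/

noncomputable section

open Literature.MathematicalPhysics.KineticTheory.HeatConduction

namespace Summit.AtomisticToContinuum.FouriersLaw.Cruxes.SuperadditiveResistance.ThermaliseThenCutProbeInsertion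

variable {N M : ℕ}

/-! ### The Hamiltonian vector field on block functions -/

/-- The Liouville part of the `(N+M)`-chain on a LEFT-block function is the left block's own
Liouville operator plus the junction force `V'(q_N - q_{N-1}) ∂_{p_{N-1}}`. -/
theorem liouville_comp_restrictLeft (P : OscillatorChain) (hU : Differentiable ℝ P.U)
    (hV : Differentiable ℝ P.V) (hN : 1 ≤ N) (hM : 1 ≤ M) (f : PhaseSpace N → ℝ)
    (x : PhaseSpace (N + M)) :
    (∑ i : Fin (N + M),
      (x.2 i * partialQ i
          (f ∘ fun y : PhaseSpace (N + M) => (y.1 ∘ Fin.castAdd M, y.2 ∘ Fin.castAdd M)) x -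
        partialQ i (P.hamiltonian (N + M)) x * partialP i
          (f ∘ fun y : PhaseSpace (N + M) => (y.1 ∘ Fin.castAdd M, y.2 ∘ Fin.castAdd M)) x)) =
      (∑ i : Fin N,
        (x.2 (Fin.castAdd M i) * partialQ i f (x.1 ∘ Fin.castAdd M, x.2 ∘ Fin.castAdd M) -
          partialQ i (P.hamiltonian N) (x.1 ∘ Fin.castAdd M, x.2 ∘ Fin.castAdd M) *
            partialP i f (x.1 ∘ Fin.castAdd M, x.2 ∘ Fin.castAdd M))) +
      deriv P.V (x.1 ⟨N, by omega⟩ - x.1 ⟨N - 1, by omega⟩) *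
        partialP ⟨N - 1, by omega⟩ f (x.1 ∘ Fin.castAdd M, x.2 ∘ Fin.castAdd M) := by
  rw [Fin.sum_univ_add]
  have hnat : ∑ j : Fin M, (x.2 (Fin.natAdd N j) * partialQ (Fin.natAdd N j)
      (f ∘ fun y : PhaseSpace (N + M) => (y.1 ∘ Fin.castAdd M, y.2 ∘ Fin.castAdd M)) x -
      partialQ (Fin.natAdd N j) (P.hamiltonian (N + M)) x * partialP (Fin.natAdd N j)
        (f ∘ fun y : PhaseSpace (N + M) => (y.1 ∘ Fin.castAdd M, y.2 ∘ Fin.castAdd M)) x) = 0 :=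
    Finset.sum_eq_zero fun j _ => by
      rw [partialQ_comp_restrictLeft_natAdd, partialP_comp_restrictLeft_natAdd]; ring
  rw [hnat, add_zero]
  simp only [partialQ_comp_restrictLeft_castAdd, partialP_comp_restrictLeft_castAdd,
    P.partialQ_hamiltonian_eq_dPotential hU hV, dPotential_castAdd P hM]
  have hsplit : ∀ i : Fin N,
      x.2 (Fin.castAdd M i) * partialQ i f (x.1 ∘ Fin.castAdd M, x.2 ∘ Fin.castAdd M) -
        (P.dPotential N i (x.1 ∘ Fin.castAdd M) -
          (if i.val + 1 = N then deriv P.V (x.1 ⟨N, by omega⟩ - x.1 (Fin.castAdd M i)) else 0)) *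
          partialP i f (x.1 ∘ Fin.castAdd M, x.2 ∘ Fin.castAdd M) =
      (x.2 (Fin.castAdd M i) * partialQ i f (x.1 ∘ Fin.castAdd M, x.2 ∘ Fin.castAdd M) -
        P.dPotential N i (x.1 ∘ Fin.castAdd M) *
          partialP i f (x.1 ∘ Fin.castAdd M, x.2 ∘ Fin.castAdd M)) +
      (if i.val + 1 = N then deriv P.V (x.1 ⟨N, by omega⟩ - x.1 (Fin.castAdd M i)) *
          partialP i f (x.1 ∘ Fin.castAdd M, x.2 ∘ Fin.castAdd M) else 0) := by
    intro i
    split_ifs <;> ring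
  simp only [hsplit, Finset.sum_add_distrib, sum_junction_castAdd P hN hM]

/-- The Liouville part of the `(N+M)`-chain on a RIGHT-block function is the right block's own
Liouville operator minus the junction force `V'(q_N - q_{N-1}) ∂_{p_N}`. -/
theorem liouville_comp_restrictRight (P : OscillatorChain) (hU : Differentiable ℝ P.U)
    (hV : Differentiable ℝ P.V) (hN : 1 ≤ N) (hM : 1 ≤ M) (f : PhaseSpace M → ℝ)
    (x : PhaseSpace (N + M)) :
    (∑ i : Fin (N + M),
      (x.2 i * partialQ i
          (f ∘ fun y : PhaseSpace (N + M) => (y.1 ∘ Fin.natAdd N, y.2 ∘ Fin.natAdd N)) x -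
        partialQ i (P.hamiltonian (N + M)) x * partialP i
          (f ∘ fun y : PhaseSpace (N + M) => (y.1 ∘ Fin.natAdd N, y.2 ∘ Fin.natAdd N)) x)) =
      (∑ j : Fin M,
        (x.2 (Fin.natAdd N j) * partialQ j f (x.1 ∘ Fin.natAdd N, x.2 ∘ Fin.natAdd N) -
          partialQ j (P.hamiltonian M) (x.1 ∘ Fin.natAdd N, x.2 ∘ Fin.natAdd N) *
            partialP j f (x.1 ∘ Fin.natAdd N, x.2 ∘ Fin.natAdd N))) -
      deriv P.V (x.1 ⟨N, by omega⟩ - x.1 ⟨N - 1, by omega⟩) *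
        partialP ⟨0, by omega⟩ f (x.1 ∘ Fin.natAdd N, x.2 ∘ Fin.natAdd N) := by
  rw [Fin.sum_univ_add]
  have hcast : ∑ i : Fin N, (x.2 (Fin.castAdd M i) * partialQ (Fin.castAdd M i)
      (f ∘ fun y : PhaseSpace (N + M) => (y.1 ∘ Fin.natAdd N, y.2 ∘ Fin.natAdd N)) x -
      partialQ (Fin.castAdd M i) (P.hamiltonian (N + M)) x * partialP (Fin.castAdd M i)
        (f ∘ fun y : PhaseSpace (N + M) => (y.1 ∘ Fin.natAdd N, y.2 ∘ Fin.natAdd N)) x) = 0 :=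
    Finset.sum_eq_zero fun i _ => by
      rw [partialQ_comp_restrictRight_castAdd, partialP_comp_restrictRight_castAdd]; ring
  rw [hcast, zero_add]
  simp only [partialQ_comp_restrictRight_natAdd, partialP_comp_restrictRight_natAdd,
    P.partialQ_hamiltonian_eq_dPotential hU hV, dPotential_natAdd P hN]
  have hsplit : ∀ j : Fin M,
      x.2 (Fin.natAdd N j) * partialQ j f (x.1 ∘ Fin.natAdd N, x.2 ∘ Fin.natAdd N) -
        (P.dPotential M j (x.1 ∘ Fin.natAdd N) +
          (if j.val = 0 then deriv P.V (x.1 (Fin.natAdd N j) - x.1 ⟨N - 1, by omega⟩) else 0)) *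
          partialP j f (x.1 ∘ Fin.natAdd N, x.2 ∘ Fin.natAdd N) =
      (x.2 (Fin.natAdd N j) * partialQ j f (x.1 ∘ Fin.natAdd N, x.2 ∘ Fin.natAdd N) -
        P.dPotential M j (x.1 ∘ Fin.natAdd N) *
          partialP j f (x.1 ∘ Fin.natAdd N, x.2 ∘ Fin.natAdd N)) -
      (if j.val = 0 then deriv P.V (x.1 (Fin.natAdd N j) - x.1 ⟨N - 1, by omega⟩) *
          partialP j f (x.1 ∘ Fin.natAdd N, x.2 ∘ Fin.natAdd N) else 0) := by
    intro j
    split_ifs <;> ring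
  simp only [hsplit, Finset.sum_sub_distrib, sum_junction_natAdd P hN hM]

/-! ### Langevin thermostat terms on block functions -/

/-- An Ornstein–Uhlenbeck thermostat term `θ ∂²_{p_s} - p_s ∂_{p_s}` of the big chain acts on a
LEFT-block function as the same thermostat of the left block (and not at all if `s ≥ N`). -/
theorem bathSum_comp_restrictLeft (s : ℕ) (θ : ℝ) (f : PhaseSpace N → ℝ)
    (x : PhaseSpace (N + M)) :
    (∑ i : Fin (N + M), if i.val = s then
        θ * partialP i (partialP i
            (f ∘ fun y : PhaseSpace (N + M) => (y.1 ∘ Fin.castAdd M, y.2 ∘ Fin.castAdd M))) x -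
          x.2 i * partialP i
            (f ∘ fun y : PhaseSpace (N + M) => (y.1 ∘ Fin.castAdd M, y.2 ∘ Fin.castAdd M)) x
      else 0) =
      ∑ i : Fin N, if i.val = s then
        θ * partialP i (partialP i f) (x.1 ∘ Fin.castAdd M, x.2 ∘ Fin.castAdd M) -
          x.2 (Fin.castAdd M i) * partialP i f (x.1 ∘ Fin.castAdd M, x.2 ∘ Fin.castAdd M)
      else 0 := by
  rw [Fin.sum_univ_add]
  have hnat : ∑ j : Fin M, (if (Fin.natAdd N j).val = s then
      θ * partialP (Fin.natAdd N j) (partialP (Fin.natAdd N j)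
          (f ∘ fun y : PhaseSpace (N + M) => (y.1 ∘ Fin.castAdd M, y.2 ∘ Fin.castAdd M))) x -
        x.2 (Fin.natAdd N j) * partialP (Fin.natAdd N j)
          (f ∘ fun y : PhaseSpace (N + M) => (y.1 ∘ Fin.castAdd M, y.2 ∘ Fin.castAdd M)) x
      else 0) = 0 :=
    Finset.sum_eq_zero fun j _ => by
      rw [partialP_partialP_comp_restrictLeft_natAdd, partialP_comp_restrictLeft_natAdd]
      split_ifs <;> ring
  rw [hnat, add_zero]
  refine Finset.sum_congr rfl fun i _ => ?_
  simp only [Fin.val_castAdd, partialP_partialP_comp_restrictLeft_castAdd,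
    partialP_comp_restrictLeft_castAdd]

/-- An Ornstein–Uhlenbeck thermostat term of the big chain at a site `s = N + t` acts on a
RIGHT-block function as the right block's thermostat at its site `t`. -/
theorem bathSum_comp_restrictRight (s t : ℕ) (hst : s = N + t) (θ : ℝ) (f : PhaseSpace M → ℝ)
    (x : PhaseSpace (N + M)) :
    (∑ i : Fin (N + M), if i.val = s then
        θ * partialP i (partialP i
            (f ∘ fun y : PhaseSpace (N + M) => (y.1 ∘ Fin.natAdd N, y.2 ∘ Fin.natAdd N))) x -
          x.2 i * partialP i
            (f ∘ fun y : PhaseSpace (N + M) => (y.1 ∘ Fin.natAdd N, y.2 ∘ Fin.natAdd N)) x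
      else 0) =
      ∑ j : Fin M, if j.val = t then
        θ * partialP j (partialP j f) (x.1 ∘ Fin.natAdd N, x.2 ∘ Fin.natAdd N) -
          x.2 (Fin.natAdd N j) * partialP j f (x.1 ∘ Fin.natAdd N, x.2 ∘ Fin.natAdd N)
      else 0 := by
  rw [Fin.sum_univ_add]
  have hcast : ∑ i : Fin N, (if (Fin.castAdd M i).val = s then
      θ * partialP (Fin.castAdd M i) (partialP (Fin.castAdd M i)
          (f ∘ fun y : PhaseSpace (N + M) => (y.1 ∘ Fin.natAdd N, y.2 ∘ Fin.natAdd N))) x -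
        x.2 (Fin.castAdd M i) * partialP (Fin.castAdd M i)
          (f ∘ fun y : PhaseSpace (N + M) => (y.1 ∘ Fin.natAdd N, y.2 ∘ Fin.natAdd N)) x
      else 0) = 0 :=
    Finset.sum_eq_zero fun i _ => by
      rw [partialP_partialP_comp_restrictRight_castAdd, partialP_comp_restrictRight_castAdd]
      split_ifs <;> ring
  rw [hcast, zero_add]
  refine Finset.sum_congr rfl fun j _ => ?_
  simp only [Fin.val_natAdd, partialP_partialP_comp_restrictRight_natAdd,
    partialP_comp_restrictRight_natAdd]
  by_cases h : j.val = t
  · rw [if_pos (by omega), if_pos h]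
  · rw [if_neg (by omega), if_neg h]

/-- A thermostat of the big chain on a LEFT-block site does not act on RIGHT-block functions. -/
theorem bathSum_comp_restrictRight_of_lt {s : ℕ} (hs : s < N) (θ : ℝ) (f : PhaseSpace M → ℝ)
    (x : PhaseSpace (N + M)) :
    (∑ i : Fin (N + M), if i.val = s then
        θ * partialP i (partialP i
            (f ∘ fun y : PhaseSpace (N + M) => (y.1 ∘ Fin.natAdd N, y.2 ∘ Fin.natAdd N))) x -
          x.2 i * partialP i
            (f ∘ fun y : PhaseSpace (N + M) => (y.1 ∘ Fin.natAdd N, y.2 ∘ Fin.natAdd N)) x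
      else 0) = 0 := by
  rw [Fin.sum_univ_add]
  have hcast : ∑ i : Fin N, (if (Fin.castAdd M i).val = s then
      θ * partialP (Fin.castAdd M i) (partialP (Fin.castAdd M i)
          (f ∘ fun y : PhaseSpace (N + M) => (y.1 ∘ Fin.natAdd N, y.2 ∘ Fin.natAdd N))) x -
        x.2 (Fin.castAdd M i) * partialP (Fin.castAdd M i)
          (f ∘ fun y : PhaseSpace (N + M) => (y.1 ∘ Fin.natAdd N, y.2 ∘ Fin.natAdd N)) x
      else 0) = 0 :=
    Finset.sum_eq_zero fun i _ => by
      rw [partialP_partialP_comp_restrictRight_castAdd, partialP_comp_restrictRight_castAdd]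
      split_ifs <;> ring
  rw [hcast, zero_add]
  exact Finset.sum_eq_zero fun j _ => if_neg (by simp only [Fin.val_natAdd]; omega)

/-! ### The generator of the big chain on block functions -/

/-- **Left block.** On a function of the left block's coordinates, the generator of the
`(N+M)`-chain (baths `T_L` at site `0`, `T_R` at site `N+M-1`) is the generator of the bare
`N`-chain between baths `T_L` and `θ`, MINUS its right-bath term (there is no thermostat on site
`N-1` of the big chain), PLUS the junction force `V'(q_N - q_{N-1}) ∂_{p_{N-1}}` — for every `θ`. -/
theorem generator_comp_restrictLeft (P : OscillatorChain) (hU : Differentiable ℝ P.U)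
    (hV : Differentiable ℝ P.V) (hN : 1 ≤ N) (hM : 1 ≤ M) (T_L T_R θ : ℝ)
    (f : PhaseSpace N → ℝ) (x : PhaseSpace (N + M)) :
    P.generator (N + M) T_L T_R
        (f ∘ fun y : PhaseSpace (N + M) => (y.1 ∘ Fin.castAdd M, y.2 ∘ Fin.castAdd M)) x =
      P.generator N T_L θ f (x.1 ∘ Fin.castAdd M, x.2 ∘ Fin.castAdd M) -
        P.γ * (∑ i : Fin N, if i.val = N - 1 then
          θ * partialP i (partialP i f) (x.1 ∘ Fin.castAdd M, x.2 ∘ Fin.castAdd M) -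
            x.2 (Fin.castAdd M i) * partialP i f (x.1 ∘ Fin.castAdd M, x.2 ∘ Fin.castAdd M)
          else 0) +
        deriv P.V (x.1 ⟨N, by omega⟩ - x.1 ⟨N - 1, by omega⟩) *
          partialP ⟨N - 1, by omega⟩ f (x.1 ∘ Fin.castAdd M, x.2 ∘ Fin.castAdd M) := by
  simp only [OscillatorChain.generator, Finset.sum_add_distrib, Function.comp_apply]
  rw [liouville_comp_restrictLeft P hU hV hN hM, bathSum_comp_restrictLeft,
    bathSum_comp_restrictLeft]
  have h0 : ∑ i : Fin N, (if i.val = N + M - 1 then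
      T_R * partialP i (partialP i f) (x.1 ∘ Fin.castAdd M, x.2 ∘ Fin.castAdd M) -
        x.2 (Fin.castAdd M i) * partialP i f (x.1 ∘ Fin.castAdd M, x.2 ∘ Fin.castAdd M)
      else 0) = 0 :=
    Finset.sum_eq_zero fun i _ => if_neg (by have := i.isLt; omega)
  rw [h0]
  ring

/-- **Right block.** On a function of the right block's coordinates, the generator of the
`(N+M)`-chain is the generator of the bare `M`-chain between baths `θ` and `T_R`, MINUS its
left-bath term, MINUS the junction force `V'(q_N - q_{N-1}) ∂_{p_N}` — for every `θ`. -/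
theorem generator_comp_restrictRight (P : OscillatorChain) (hU : Differentiable ℝ P.U)
    (hV : Differentiable ℝ P.V) (hN : 1 ≤ N) (hM : 1 ≤ M) (T_L T_R θ : ℝ)
    (f : PhaseSpace M → ℝ) (x : PhaseSpace (N + M)) :
    P.generator (N + M) T_L T_R
        (f ∘ fun y : PhaseSpace (N + M) => (y.1 ∘ Fin.natAdd N, y.2 ∘ Fin.natAdd N)) x =
      P.generator M θ T_R f (x.1 ∘ Fin.natAdd N, x.2 ∘ Fin.natAdd N) -
        P.γ * (∑ j : Fin M, if j.val = 0 then
          θ * partialP j (partialP j f) (x.1 ∘ Fin.natAdd N, x.2 ∘ Fin.natAdd N) -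
            x.2 (Fin.natAdd N j) * partialP j f (x.1 ∘ Fin.natAdd N, x.2 ∘ Fin.natAdd N)
          else 0) -
        deriv P.V (x.1 ⟨N, by omega⟩ - x.1 ⟨N - 1, by omega⟩) *
          partialP ⟨0, by omega⟩ f (x.1 ∘ Fin.natAdd N, x.2 ∘ Fin.natAdd N) := by
  simp only [OscillatorChain.generator, Finset.sum_add_distrib, Function.comp_apply]
  rw [liouville_comp_restrictRight P hU hV hN hM, bathSum_comp_restrictRight_of_lt (by omega),
    bathSum_comp_restrictRight (N + M - 1) (M - 1) (by omega)]
  ring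

/-! ### The probed device on block functions

The DEVICE of the line (split `(N, M)`, terminal temperatures `τ 0, τ 1, τ 2, τ 3` on sites
`0, N-1, N, N+M-1`) has generator `deviceGenerator P N M τ f x = P.generator (N + M) (τ 0) (τ 3) f x
+ P.γ * (thermo (N+M) (N-1) (τ 1) f x + thermo (N+M) N (τ 2) f x)`, where
`thermo L s θ f x = ∑ i : Fin L, if i.val = s then θ * ∂_{p_i}∂_{p_i} f x - p_i ∂_{p_i} f x else 0`;
below these sums are unfolded. -/

/-- **The device restricted to the left block IS the bare `N`-chain plus the junction force.**
On functions of the sites `0, …, N-1`, the device generator equals the generator of the bare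
`N`-chain between baths `τ 0` (site `0`) and `τ 1` (site `N-1`: the probe plays the bare chain's
right bath, same coupling `γ`) plus `V'(q_N - q_{N-1}) ∂_{p_{N-1}}`; nothing else of what is
attached beyond site `N-1` (probe on `N`, the `M-1` further sites, the far bath) is seen. -/
theorem device_comp_restrictLeft : ∀ {N M : ℕ} (P : OscillatorChain) (hU : Differentiable ℝ P.U) (hV : Differentiable ℝ P.V) (hN : 1 ≤ N) (hM : 1 ≤ M) (τ : Fin 4 → ℝ) (f : PhaseSpace N → ℝ) (x : PhaseSpace (N + M)), P.generator (N + M) (τ 0) (τ 3) (f ∘ fun y : PhaseSpace (N + M) => (y.1 ∘ Fin.castAdd M, y.2 ∘ Fin.castAdd M)) x + P.γ * ((∑ i : Fin (N + M), if i.val = N - 1 then τ 1 * partialP i (partialP i (f ∘ fun y : PhaseSpace (N + M) => (y.1 ∘ Fin.castAdd M, y.2 ∘ Fin.castAdd M))) x - x.2 i * partialP i (f ∘ fun y : PhaseSpace (N + M) => (y.1 ∘ Fin.castAdd M, y.2 ∘ Fin.castAdd M)) x else 0) + (∑ i : Fin (N + M), if i.val = N then τ 2 * partialP i (partialP i (f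 ∘ fun y : PhaseSpace (N + M) => (y.1 ∘ Fin.castAdd M, y.2 ∘ Fin.castAdd M))) x - x.2 i * partialP i (f ∘ fun y : PhaseSpace (N + M) => (y.1 ∘ Fin.castAdd M, y.2 ∘ Fin.castAdd M)) x else 0)) = P.generator N (τ 0) (τ 1) f (x.1 ∘ Fin.castAdd M, x.2 ∘ Fin.castAdd M) + deriv P.V (x.1 ⟨N, by omega⟩ - x.1 ⟨N - 1, by omega⟩) * partialP ⟨N - 1, by omega⟩ f (x.1 ∘ Fin.castAdd M, x.2 ∘ Fin.castAdd M) := by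
  intro N M P hU hV hN hM τ f x
  rw [generator_comp_restrictLeft P hU hV hN hM (τ 0) (τ 3) (τ 1), bathSum_comp_restrictLeft,
    bathSum_comp_restrictLeft]
  have h0 : ∑ i : Fin N, (if i.val = N then
      τ 2 * partialP i (partialP i f) (x.1 ∘ Fin.castAdd M, x.2 ∘ Fin.castAdd M) -
        x.2 (Fin.castAdd M i) * partialP i f (x.1 ∘ Fin.castAdd M, x.2 ∘ Fin.castAdd M)
      else 0) = 0 :=
    Finset.sum_eq_zero fun i _ => if_neg (by have := i.isLt; omega)
  rw [h0]
  ring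

/-- **The device restricted to the right block IS the bare `M`-chain minus the junction force.**
On functions of the sites `N, …, N+M-1`, the device generator equals the generator of the bare
`M`-chain between baths `τ 2` (its site `0` = the probed site `N`) and `τ 3` (the far bath) minus
`V'(q_N - q_{N-1}) ∂_{p_N}`. -/
theorem device_comp_restrictRight (P : OscillatorChain) (hU : Differentiable ℝ P.U)
    (hV : Differentiable ℝ P.V) (hN : 1 ≤ N) (hM : 1 ≤ M) (τ : Fin 4 → ℝ)
    (f : PhaseSpace M → ℝ) (x : PhaseSpace (N + M)) :
    P.generator (N + M) (τ 0) (τ 3)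
        (f ∘ fun y : PhaseSpace (N + M) => (y.1 ∘ Fin.natAdd N, y.2 ∘ Fin.natAdd N)) x +
      P.γ * ((∑ i : Fin (N + M), if i.val = N - 1 then
          τ 1 * partialP i (partialP i
              (f ∘ fun y : PhaseSpace (N + M) => (y.1 ∘ Fin.natAdd N, y.2 ∘ Fin.natAdd N))) x -
            x.2 i * partialP i
              (f ∘ fun y : PhaseSpace (N + M) => (y.1 ∘ Fin.natAdd N, y.2 ∘ Fin.natAdd N)) x
          else 0) +
        (∑ i : Fin (N + M), if i.val = N then
          τ 2 * partialP i (partialP i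
              (f ∘ fun y : PhaseSpace (N + M) => (y.1 ∘ Fin.natAdd N, y.2 ∘ Fin.natAdd N))) x -
            x.2 i * partialP i
              (f ∘ fun y : PhaseSpace (N + M) => (y.1 ∘ Fin.natAdd N, y.2 ∘ Fin.natAdd N)) x
          else 0)) =
      P.generator M (τ 2) (τ 3) f (x.1 ∘ Fin.natAdd N, x.2 ∘ Fin.natAdd N) -
        deriv P.V (x.1 ⟨N, by omega⟩ - x.1 ⟨N - 1, by omega⟩) *
          partialP ⟨0, by omega⟩ f (x.1 ∘ Fin.natAdd N, x.2 ∘ Fin.natAdd N) := by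
  rw [generator_comp_restrictRight P hU hV hN hM (τ 0) (τ 3) (τ 2),
    bathSum_comp_restrictRight_of_lt (by omega), bathSum_comp_restrictRight N 0 (by omega)]
  ring

/-! ### The crux's chain `pinnedChain ω₂ lam β γ` (polynomial potentials, `V'(r) = r + β r³`) -/

/-- Left block of the device built on `pinnedChain ω₂ lam β γ`: bare `N`-chain (baths `τ 0`,
`τ 1`) plus the explicit junction force `(r + β r³) ∂_{p_{N-1}}`, `r = q_N - q_{N-1}`. -/
theorem pinnedChain_device_comp_restrictLeft (ω₂ lam β γ : ℝ) (hN : 1 ≤ N) (hM : 1 ≤ M)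
    (τ : Fin 4 → ℝ) (f : PhaseSpace N → ℝ) (x : PhaseSpace (N + M)) :
    (pinnedChain ω₂ lam β γ).generator (N + M) (τ 0) (τ 3)
        (f ∘ fun y : PhaseSpace (N + M) => (y.1 ∘ Fin.castAdd M, y.2 ∘ Fin.castAdd M)) x +
      γ * ((∑ i : Fin (N + M), if i.val = N - 1 then
          τ 1 * partialP i (partialP i
              (f ∘ fun y : PhaseSpace (N + M) => (y.1 ∘ Fin.castAdd M, y.2 ∘ Fin.castAdd M))) x -
            x.2 i * partialP i
              (f ∘ fun y : PhaseSpace (N + M) => (y.1 ∘ Fin.castAdd M, y.2 ∘ Fin.castAdd M)) x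
          else 0) +
        (∑ i : Fin (N + M), if i.val = N then
          τ 2 * partialP i (partialP i
              (f ∘ fun y : PhaseSpace (N + M) => (y.1 ∘ Fin.castAdd M, y.2 ∘ Fin.castAdd M))) x -
            x.2 i * partialP i
              (f ∘ fun y : PhaseSpace (N + M) => (y.1 ∘ Fin.castAdd M, y.2 ∘ Fin.castAdd M)) x
          else 0)) =
      (pinnedChain ω₂ lam β γ).generator N (τ 0) (τ 1) f
          (x.1 ∘ Fin.castAdd M, x.2 ∘ Fin.castAdd M) +
        ((x.1 ⟨N, by omega⟩ - x.1 ⟨N - 1, by omega⟩) +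
            β * (x.1 ⟨N, by omega⟩ - x.1 ⟨N - 1, by omega⟩) ^ 3) *
          partialP ⟨N - 1, by omega⟩ f (x.1 ∘ Fin.castAdd M, x.2 ∘ Fin.castAdd M) := by
  rw [← pinnedChain_deriv_V ω₂ lam β γ]
  exact device_comp_restrictLeft (pinnedChain ω₂ lam β γ)
    ((pinnedChain_contDiff_U ω₂ lam β γ (n := 1)).differentiable one_ne_zero)
    ((pinnedChain_contDiff_V ω₂ lam β γ (n := 1)).differentiable one_ne_zero) hN hM τ f x

/-- Right block of the device built on `pinnedChain ω₂ lam β γ`: bare `M`-chain (baths `τ 2`,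
`τ 3`) minus the explicit junction force `(r + β r³) ∂_{p_N}`, `r = q_N - q_{N-1}`. -/
theorem pinnedChain_device_comp_restrictRight (ω₂ lam β γ : ℝ) (hN : 1 ≤ N) (hM : 1 ≤ M)
    (τ : Fin 4 → ℝ) (f : PhaseSpace M → ℝ) (x : PhaseSpace (N + M)) :
    (pinnedChain ω₂ lam β γ).generator (N + M) (τ 0) (τ 3)
        (f ∘ fun y : PhaseSpace (N + M) => (y.1 ∘ Fin.natAdd N, y.2 ∘ Fin.natAdd N)) x +
      γ * ((∑ i : Fin (N + M), if i.val = N - 1 then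
          τ 1 * partialP i (partialP i
              (f ∘ fun y : PhaseSpace (N + M) => (y.1 ∘ Fin.natAdd N, y.2 ∘ Fin.natAdd N))) x -
            x.2 i * partialP i
              (f ∘ fun y : PhaseSpace (N + M) => (y.1 ∘ Fin.natAdd N, y.2 ∘ Fin.natAdd N)) x
          else 0) +
        (∑ i : Fin (N + M), if i.val = N then
          τ 2 * partialP i (partialP i
              (f ∘ fun y : PhaseSpace (N + M) => (y.1 ∘ Fin.natAdd N, y.2 ∘ Fin.natAdd N))) x -
            x.2 i * partialP i
              (f ∘ fun y : PhaseSpace (N + M) => (y.1 ∘ Fin.natAdd N, y.2 ∘ Fin.natAdd N)) x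
          else 0)) =
      (pinnedChain ω₂ lam β γ).generator M (τ 2) (τ 3) f
          (x.1 ∘ Fin.natAdd N, x.2 ∘ Fin.natAdd N) -
        ((x.1 ⟨N, by omega⟩ - x.1 ⟨N - 1, by omega⟩) +
            β * (x.1 ⟨N, by omega⟩ - x.1 ⟨N - 1, by omega⟩) ^ 3) *
          partialP ⟨0, by omega⟩ f (x.1 ∘ Fin.natAdd N, x.2 ∘ Fin.natAdd N) := by
  rw [← pinnedChain_deriv_V ω₂ lam β γ]
  exact device_comp_restrictRight (pinnedChain ω₂ lam β γ)
    ((pinnedChain_contDiff_U ω₂ lam β γ (n := 1)).differentiable one_ne_zero)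
    ((pinnedChain_contDiff_V ω₂ lam β γ (n := 1)).differentiable one_ne_zero) hN hM τ f x

end Summit.AtomisticToContinuum.FouriersLaw.Cruxes.SuperadditiveResistance.ThermaliseThenCutProbeInsertion

end
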